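import Mathlib
import Summits.NavierStokesRegularity.NavierStokesRegularity.Theorems.ThreadingFluxHorizonTowerNullConeZonalAxis
import HarnessLib

/-!
# Crux `PoloidalLiouville` (stmt-NavierStokesRegularity-1222), crux idea «horizon-threading-tower» (ns-idea-15):
# THE QUADRATIC GENERATOR — the harmonic projections `π₄(L²)`, `π₆(L³)` of the powers of a harmonic quadratic form

Support file (`--supports stmt-NavierStokesRegularity-1222`, helper; cell `ns-wall-extremal`, width hand ns-wall-eng-3 g5; 0 kit), toward
THM E «the finite tower `{2, 4, 6}` is coaxially zonal at order one» (`…FiniteTowerTwoFourSix`).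

For the traceless symmetric matrix `Q = [[a, d, e], [d, b, f], [e, f, −a−b]]` over a commutative ring `R` we define the polynomials on
`R³`
* `genL = xᵀQx` (the GENERATOR: a harmonic quadratic form), `genM = |Qx|² = xᵀQ²x`, `genW = det(x, Qx, Q²x)`,
* the scalars `genTau = tr Q²`, `genDelta = det Q`, and `normSq = x₀² + x₁² + x₂²` (`ρ`),
* `genA = 35 L² − 20 ρ M + 2τ ρ²` and `genB = 77 L³ − 84 ρ L M + 14 τ ρ² L + 16 δ ρ³`,
and prove: `genA`, `genB` are HARMONIC (`lapP = 0`; they are `35 · π₄(L²)` and `77 · π₆(L³)`), homogeneous of degrees `4`, `6`; the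
gradient pairings `∇L·∇L = 4M`, `∇L·∇M = 2τ L + 4δ ρ` (Cayley–Hamilton), `∇L·∇ρ = 4L`, `∇M·∇ρ = 4M`.  The bracket table
(`{L, M} = 4W`, `{A, B} = −560 ρ W (9L² + 12ρM − 2τρ²)`, …), the coefficient-map / scaling lemmas and the chart lemmas are in the
companion files `…QuadraticGeneratorBrackets` / `…QuadraticGeneratorChart`.

HONEST LABEL: polynomial identities about one crux idea's typed objects; no Prop of the sketch is closed here; `HorizonTowerZonality`
(general towers), `PoloidalLiouville` (1222) OPEN; NS regularity NOT proved.  [folklore]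
-/

-- the summit and its single sub-problem share the name (CONVENTIONS §1)
set_option linter.dupNamespace false

noncomputable section

open MvPolynomial

namespace Summit.NavierStokesRegularity.NavierStokesRegularity.Theorems.PoloidalLiouville.HorizonTower.Zonal

section Generic

variable {R : Type*} [CommRing R]

/-! ### The objects -/

/-- `ρ = x₀² + x₁² + x₂²`. -/
def normSq : MvPolynomial (Fin 3) R := X 0 ^ 2 + X 1 ^ 2 + X 2 ^ 2

set_option linter.unusedVariables false in
/-- The first row `(Qx)₀` of `Qx`, `Q = [[a,d,e],[d,b,f],[e,f,−a−b]]` (all five parameters are kept in every signature). -/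
def genQ0 (a b d e f : R) : MvPolynomial (Fin 3) R := C a * X 0 + C d * X 1 + C e * X 2
set_option linter.unusedVariables false in
/-- The second row `(Qx)₁`. -/
def genQ1 (a b d e f : R) : MvPolynomial (Fin 3) R := C d * X 0 + C b * X 1 + C f * X 2
set_option linter.unusedVariables false in
/-- The third row `(Qx)₂` (the trace is zero: `Q₂₂ = −a−b`). -/
def genQ2 (a b d e f : R) : MvPolynomial (Fin 3) R := C e * X 0 + C f * X 1 - C (a + b) * X 2

/-- The GENERATOR `L = xᵀQx`. -/
def genL (a b d e f : R) : MvPolynomial (Fin 3) R :=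
  X 0 * genQ0 a b d e f + X 1 * genQ1 a b d e f + X 2 * genQ2 a b d e f

/-- `M = |Qx|² = xᵀQ²x`. -/
def genM (a b d e f : R) : MvPolynomial (Fin 3) R :=
  genQ0 a b d e f ^ 2 + genQ1 a b d e f ^ 2 + genQ2 a b d e f ^ 2

/-- The first row `(Q²x)₀`. -/
def genS0 (a b d e f : R) : MvPolynomial (Fin 3) R := C a * genQ0 a b d e f + C d * genQ1 a b d e f + C e * genQ2 a b d e f
/-- The second row `(Q²x)₁`. -/
def genS1 (a b d e f : R) : MvPolynomial (Fin 3) R := C d * genQ0 a b d e f + C b * genQ1 a b d e f + C f * genQ2 a b d e f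
/-- The third row `(Q²x)₂`. -/
def genS2 (a b d e f : R) : MvPolynomial (Fin 3) R :=
  C e * genQ0 a b d e f + C f * genQ1 a b d e f - C (a + b) * genQ2 a b d e f

/-- `W = det(x, Qx, Q²x)` (the cubic that vanishes iff `Q` has a repeated eigenvalue). -/
def genW (a b d e f : R) : MvPolynomial (Fin 3) R :=
  X 0 * (genQ1 a b d e f * genS2 a b d e f - genQ2 a b d e f * genS1 a b d e f)
    + X 1 * (genQ2 a b d e f * genS0 a b d e f - genQ0 a b d e f * genS2 a b d e f)
    + X 2 * (genQ0 a b d e f * genS1 a b d e f - genQ1 a b d e f * genS0 a b d e f)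

/-- `τ = tr Q²`. -/
def genTau (a b d e f : R) : R := a ^ 2 + b ^ 2 + (a + b) ^ 2 + 2 * (d ^ 2 + e ^ 2 + f ^ 2)

/-- `δ = det Q`. -/
def genDelta (a b d e f : R) : R := -(a * b * (a + b)) + 2 * d * e * f - a * f ^ 2 - b * e ^ 2 + (a + b) * d ^ 2

/-- `A = 35 L² − 20 ρ M + 2 τ ρ² = 35 · π₄(L²)` (the harmonic projection of `L²`). -/
def genA (a b d e f : R) : MvPolynomial (Fin 3) R :=
  C 35 * genL a b d e f ^ 2 - C 20 * normSq * genM a b d e f + C (2 * genTau a b d e f) * normSq ^ 2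

/-- `B = 77 L³ − 84 ρ L M + 14 τ ρ² L + 16 δ ρ³ = 77 · π₆(L³)` (the harmonic projection of `L³`). -/
def genB (a b d e f : R) : MvPolynomial (Fin 3) R :=
  C 77 * genL a b d e f ^ 3 - C 84 * normSq * genL a b d e f * genM a b d e f
    + C (14 * genTau a b d e f) * normSq ^ 2 * genL a b d e f + C (16 * genDelta a b d e f) * normSq ^ 3

/-! ### Leibniz rules for `lapP` and `dotP` -/

/-- `dotP` is symmetric. [folklore] -/
theorem dotP_comm (p q : MvPolynomial (Fin 3) R) : dotP p q = dotP q p := by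
  unfold dotP; ring

/-- `dotP` is additive on the left. [folklore] -/
theorem dotP_add_left (p q r : MvPolynomial (Fin 3) R) : dotP (p + q) r = dotP p r + dotP q r := by
  simp only [dotP, map_add]; ring

/-- `dotP` of a difference on the left. [folklore] -/
theorem dotP_sub_left (p q r : MvPolynomial (Fin 3) R) : dotP (p - q) r = dotP p r - dotP q r := by
  simp only [dotP, map_sub]; ring

/-- `dotP` commutes with constants on the left. [folklore] -/
theorem dotP_C_mul_left (c : R) (p r : MvPolynomial (Fin 3) R) : dotP (C c * p) r = C c * dotP p r := by
  simp only [dotP, pderiv_C_mul]; ring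

/-- Leibniz rule for `dotP` on the left: `∇(pq)·∇r = p ∇q·∇r + q ∇p·∇r`. [folklore] -/
theorem dotP_mul_left (p q r : MvPolynomial (Fin 3) R) : dotP (p * q) r = p * dotP q r + q * dotP p r := by
  simp only [dotP, Derivation.leibniz, smul_eq_mul]; ring

/-- Leibniz rule for the Laplacian: `Δ(pq) = p Δq + q Δp + 2 ∇p·∇q`. [folklore] -/
theorem lapP_mul (p q : MvPolynomial (Fin 3) R) : lapP (p * q) = p * lapP q + q * lapP p + C 2 * dotP p q := by
  simp only [lapP, dotP, Derivation.leibniz, smul_eq_mul, map_add]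
  simp only [map_ofNat]
  ring

/-! ### First derivatives of the objects -/

/-- `∂₁x₀ = 0`. -/
private theorem pd10 : pderiv 1 (X 0 : MvPolynomial (Fin 3) R) = 0 := pderiv_X_of_ne (by decide)
/-- `∂₂x₀ = 0`. -/
private theorem pd20 : pderiv 2 (X 0 : MvPolynomial (Fin 3) R) = 0 := pderiv_X_of_ne (by decide)
/-- `∂₀x₁ = 0`. -/
private theorem pd01 : pderiv 0 (X 1 : MvPolynomial (Fin 3) R) = 0 := pderiv_X_of_ne (by decide)
/-- `∂₂x₁ = 0`. -/
private theorem pd21 : pderiv 2 (X 1 : MvPolynomial (Fin 3) R) = 0 := pderiv_X_of_ne (by decide)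
/-- `∂₀x₂ = 0`. -/
private theorem pd02 : pderiv 0 (X 2 : MvPolynomial (Fin 3) R) = 0 := pderiv_X_of_ne (by decide)
/-- `∂₁x₂ = 0`. -/
private theorem pd12 : pderiv 1 (X 2 : MvPolynomial (Fin 3) R) = 0 := pderiv_X_of_ne (by decide)

/-- `∂₀ ρ = 2x₀`. [folklore] -/
theorem pderiv_zero_normSq : pderiv 0 (normSq : MvPolynomial (Fin 3) R) = C 2 * X 0 := by
  simp only [normSq, map_add, Derivation.leibniz_pow, pderiv_X_self, pd01, pd02, smul_eq_mul, map_ofNat]; ring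
/-- `∂₁ ρ = 2x₁`. [folklore] -/
theorem pderiv_one_normSq : pderiv 1 (normSq : MvPolynomial (Fin 3) R) = C 2 * X 1 := by
  simp only [normSq, map_add, Derivation.leibniz_pow, pderiv_X_self, pd10, pd12, smul_eq_mul, map_ofNat]; ring
/-- `∂₂ ρ = 2x₂`. [folklore] -/
theorem pderiv_two_normSq : pderiv 2 (normSq : MvPolynomial (Fin 3) R) = C 2 * X 2 := by
  simp only [normSq, map_add, Derivation.leibniz_pow, pderiv_X_self, pd20, pd21, smul_eq_mul, map_ofNat]; ring

variable (a b d e f : R)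

/-- `∂₀ L = 2 (Qx)₀`. [folklore] -/
theorem pderiv_zero_genL : pderiv 0 (genL a b d e f) = C 2 * genQ0 a b d e f := by
  simp only [genL, genQ0, genQ1, genQ2, map_add, map_sub, Derivation.leibniz, pderiv_C, pderiv_X_self, pd01, pd02,
    smul_eq_mul, mul_zero, add_zero, mul_one]
  simp only [map_ofNat]; ring
/-- `∂₁ L = 2 (Qx)₁`. [folklore] -/
theorem pderiv_one_genL : pderiv 1 (genL a b d e f) = C 2 * genQ1 a b d e f := by
  simp only [genL, genQ0, genQ1, genQ2, map_add, map_sub, Derivation.leibniz, pderiv_C, pderiv_X_self, pd10, pd12,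
    smul_eq_mul, mul_zero, add_zero, zero_add, mul_one]
  simp only [map_ofNat]; ring
/-- `∂₂ L = 2 (Qx)₂`. [folklore] -/
theorem pderiv_two_genL : pderiv 2 (genL a b d e f) = C 2 * genQ2 a b d e f := by
  simp only [genL, genQ0, genQ1, genQ2, map_add, map_sub, Derivation.leibniz, pderiv_C, pderiv_X_self, pd20, pd21,
    smul_eq_mul, mul_zero, add_zero, zero_add, mul_one]
  simp only [map_ofNat]; ring

/-- `∂₀ M = 2 (Q²x)₀`. [folklore] -/
theorem pderiv_zero_genM : pderiv 0 (genM a b d e f) = C 2 * genS0 a b d e f := by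
  simp only [genM, genS0, genQ0, genQ1, genQ2, map_add, map_sub, Derivation.leibniz, Derivation.leibniz_pow, pderiv_C,
    pderiv_X_self, pd01, pd02, smul_eq_mul, mul_zero, add_zero, mul_one]
  simp only [map_ofNat]; ring
/-- `∂₁ M = 2 (Q²x)₁`. [folklore] -/
theorem pderiv_one_genM : pderiv 1 (genM a b d e f) = C 2 * genS1 a b d e f := by
  simp only [genM, genS1, genQ0, genQ1, genQ2, map_add, map_sub, Derivation.leibniz, Derivation.leibniz_pow, pderiv_C,
    pderiv_X_self, pd10, pd12, smul_eq_mul, mul_zero, add_zero, zero_add, mul_one]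
  simp only [map_ofNat]; ring
/-- `∂₂ M = 2 (Q²x)₂`. [folklore] -/
theorem pderiv_two_genM : pderiv 2 (genM a b d e f) = C 2 * genS2 a b d e f := by
  simp only [genM, genS2, genQ0, genQ1, genQ2, map_add, map_sub, Derivation.leibniz, Derivation.leibniz_pow, pderiv_C,
    pderiv_X_self, pd20, pd21, smul_eq_mul, mul_zero, add_zero, zero_add, mul_one]
  simp only [map_ofNat]; ring

/-! ### Laplacians and gradient pairings of the objects -/

/-- `Δρ = 6`. [folklore] -/
theorem lapP_normSq : lapP (normSq : MvPolynomial (Fin 3) R) = C 6 := by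
  rw [lapP, pderiv_zero_normSq, pderiv_one_normSq, pderiv_two_normSq, pderiv_C_mul, pderiv_C_mul, pderiv_C_mul,
    pderiv_X_self, pderiv_X_self, pderiv_X_self]
  simp only [map_ofNat]; ring

/-- The generator is HARMONIC: `ΔL = 2 tr Q = 0`. [folklore] -/
theorem lapP_genL : lapP (genL a b d e f) = 0 := by
  rw [lapP, pderiv_zero_genL, pderiv_one_genL, pderiv_two_genL, pderiv_C_mul, pderiv_C_mul, pderiv_C_mul]
  simp only [genQ0, genQ1, genQ2, map_add, map_sub, Derivation.leibniz, pderiv_C, pderiv_X_self, pd01, pd02, pd10, pd12,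
    pd20, pd21, smul_eq_mul, mul_zero, add_zero, zero_add, mul_one]
  simp only [map_ofNat]
  ring

/-- `ΔM = 2 tr Q² = 2τ`. [folklore] -/
theorem lapP_genM : lapP (genM a b d e f) = C (2 * genTau a b d e f) := by
  rw [lapP, pderiv_zero_genM, pderiv_one_genM, pderiv_two_genM, pderiv_C_mul, pderiv_C_mul, pderiv_C_mul]
  simp only [genS0, genS1, genS2, genQ0, genQ1, genQ2, genTau, map_add, map_sub, Derivation.leibniz, pderiv_C,
    pderiv_X_self, pd01, pd02, pd10, pd12, pd20, pd21, smul_eq_mul, mul_zero, add_zero, zero_add, mul_one]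
  simp only [map_ofNat, map_add, map_mul, map_pow]
  ring

/-- `∇ρ·∇ρ = 4ρ`. [folklore] -/
theorem dotP_normSq_normSq : dotP (normSq : MvPolynomial (Fin 3) R) normSq = C 4 * normSq := by
  rw [dotP, pderiv_zero_normSq, pderiv_one_normSq, pderiv_two_normSq]
  unfold normSq
  simp only [map_ofNat]; ring

/-- `∇L·∇ρ = 4L` (Euler). [folklore] -/
theorem dotP_genL_normSq : dotP (genL a b d e f) normSq = C 4 * genL a b d e f := by
  rw [dotP, pderiv_zero_genL, pderiv_one_genL, pderiv_two_genL, pderiv_zero_normSq, pderiv_one_normSq,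
    pderiv_two_normSq]
  unfold genL
  simp only [map_ofNat]; ring

/-- `∇M·∇ρ = 4M` (Euler). [folklore] -/
theorem dotP_genM_normSq : dotP (genM a b d e f) normSq = C 4 * genM a b d e f := by
  rw [dotP, pderiv_zero_genM, pderiv_one_genM, pderiv_two_genM, pderiv_zero_normSq, pderiv_one_normSq,
    pderiv_two_normSq]
  unfold genM genS0 genS1 genS2 genQ0 genQ1 genQ2
  simp only [map_ofNat, map_add]; ring

/-- `∇L·∇L = 4|Qx|² = 4M`. [folklore] -/
theorem dotP_genL_genL : dotP (genL a b d e f) (genL a b d e f) = C 4 * genM a b d e f := by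
  rw [dotP, pderiv_zero_genL, pderiv_one_genL, pderiv_two_genL]
  unfold genM
  simp only [map_ofNat]; ring

/-- **Cayley–Hamilton**: `∇L·∇M = 4 xᵀQ³x = 2τ L + 4δ ρ` (`Q³ = (τ/2) Q + δ I` for traceless `Q`). [folklore] -/
theorem dotP_genL_genM : dotP (genL a b d e f) (genM a b d e f)
    = C (2 * genTau a b d e f) * genL a b d e f + C (4 * genDelta a b d e f) * normSq := by
  rw [dotP, pderiv_zero_genL, pderiv_one_genL, pderiv_two_genL, pderiv_zero_genM, pderiv_one_genM, pderiv_two_genM]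
  simp only [genL, normSq, genS0, genS1, genS2, genQ0, genQ1, genQ2, genTau, genDelta, map_ofNat, map_add, map_mul,
    map_sub, map_neg, map_pow]
  ring

/-! ### Harmonicity of `A` and `B` -/

/-- ★ **`A = 35 L² − 20 ρ M + 2τ ρ²` IS HARMONIC** (it is `35 · π₄(L²)`). [folklore] -/
theorem lapP_genA : lapP (genA a b d e f) = 0 := by
  have h1 : lapP (genL a b d e f ^ 2) = C 8 * genM a b d e f := by
    rw [pow_two, lapP_mul, lapP_genL, dotP_genL_genL]; simp only [map_ofNat]; ring
  have h2 : lapP (normSq * genM a b d e f) = C (2 * genTau a b d e f) * normSq + C 14 * genM a b d e f := by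
    rw [lapP_mul, lapP_genM, lapP_normSq, dotP_comm, dotP_genM_normSq]
    simp only [map_ofNat, map_mul]; ring
  have h3 : lapP ((normSq : MvPolynomial (Fin 3) R) ^ 2) = C 20 * normSq := by
    rw [pow_two, lapP_mul, lapP_normSq, dotP_normSq_normSq]; simp only [map_ofNat]; ring
  unfold genA
  simp only [lapP_add, lapP_sub, mul_assoc, lapP_C_mul, h1, h2, h3]
  simp only [map_ofNat, map_mul]
  ring

/-- ★ **`B = 77 L³ − 84 ρ L M + 14 τ ρ² L + 16 δ ρ³` IS HARMONIC** (it is `77 · π₆(L³)`). [folklore] -/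
theorem lapP_genB : lapP (genB a b d e f) = 0 := by
  have hL := lapP_genL a b d e f
  have h1 : lapP (genL a b d e f ^ 3) = C 24 * genL a b d e f * genM a b d e f := by
    rw [pow_succ, pow_two, lapP_mul, lapP_mul, hL, dotP_genL_genL, dotP_mul_left, dotP_genL_genL]
    simp only [map_ofNat]; ring
  have h2 : lapP (normSq * (genL a b d e f * genM a b d e f))
      = C (6 * genTau a b d e f) * normSq * genL a b d e f + C 22 * genL a b d e f * genM a b d e f
        + C (8 * genDelta a b d e f) * normSq ^ 2 := by
    have e1 : dotP normSq (genL a b d e f * genM a b d e f)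
        = genL a b d e f * (C 4 * genM a b d e f) + genM a b d e f * (C 4 * genL a b d e f) := by
      rw [dotP_comm, dotP_mul_left, dotP_genM_normSq, dotP_genL_normSq]
    rw [lapP_mul, lapP_mul, lapP_genM, lapP_normSq, hL, dotP_genL_genM, e1]
    simp only [map_ofNat, map_mul]; ring
  have h3 : lapP ((normSq : MvPolynomial (Fin 3) R) ^ 2 * genL a b d e f) = C 36 * normSq * genL a b d e f := by
    have e1 : dotP (normSq * normSq) (genL a b d e f) = normSq * (C 4 * genL a b d e f) + normSq * (C 4 * genL a b d e f) := by
      rw [dotP_mul_left, dotP_comm, dotP_genL_normSq]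
    rw [pow_two, lapP_mul, hL, lapP_mul, lapP_normSq, dotP_normSq_normSq, e1]
    simp only [map_ofNat]; ring
  have h4 : lapP ((normSq : MvPolynomial (Fin 3) R) ^ 3) = C 42 * normSq ^ 2 := by
    rw [pow_succ, pow_two, lapP_mul, lapP_mul, lapP_normSq, dotP_normSq_normSq, dotP_mul_left, dotP_normSq_normSq]
    simp only [map_ofNat]; ring
  unfold genB
  simp only [lapP_add, lapP_sub, mul_assoc, lapP_C_mul, h1, h2, h3, h4]
  simp only [map_ofNat, map_mul]
  ring

/-! ### Homogeneity -/

/-- `ρ` is homogeneous of degree two. [folklore] -/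
theorem isHomogeneous_normSq : (normSq : MvPolynomial (Fin 3) R).IsHomogeneous 2 := by
  unfold normSq
  exact ((isHomogeneous_X_pow (0 : Fin 3) 2).add (isHomogeneous_X_pow 1 2)).add (isHomogeneous_X_pow 2 2)

/-- A linear form is homogeneous of degree one. -/
private theorem isHomogeneous_row (u v w : R) :
    (C u * X 0 + C v * X 1 + C w * X 2 : MvPolynomial (Fin 3) R).IsHomogeneous 1 :=
  (((isHomogeneous_X R (0 : Fin 3)).C_mul u).add ((isHomogeneous_X R (1 : Fin 3)).C_mul v)).add
    ((isHomogeneous_X R (2 : Fin 3)).C_mul w)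

/-- A linear form is homogeneous of degree one. -/
private theorem isHomogeneous_row' (u v w : R) :
    (C u * X 0 + C v * X 1 - C w * X 2 : MvPolynomial (Fin 3) R).IsHomogeneous 1 :=
  (((isHomogeneous_X R (0 : Fin 3)).C_mul u).add ((isHomogeneous_X R (1 : Fin 3)).C_mul v)).sub
    ((isHomogeneous_X R (2 : Fin 3)).C_mul w)

/-- The rows of `Qx` are linear forms. [folklore] -/
theorem isHomogeneous_genQ0 : (genQ0 a b d e f).IsHomogeneous 1 := isHomogeneous_row a d e
/-- The rows of `Qx` are linear forms. [folklore] -/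
theorem isHomogeneous_genQ1 : (genQ1 a b d e f).IsHomogeneous 1 := isHomogeneous_row d b f
/-- The rows of `Qx` are linear forms. [folklore] -/
theorem isHomogeneous_genQ2 : (genQ2 a b d e f).IsHomogeneous 1 := isHomogeneous_row' e f (a + b)

/-- A constant-coefficient combination keeps the degree. -/
private theorem isHomogeneous_comb {p q r : MvPolynomial (Fin 3) R} {n : ℕ} (hp : p.IsHomogeneous n)
    (hq : q.IsHomogeneous n) (hr : r.IsHomogeneous n) (u v w : R) : (C u * p + C v * q + C w * r).IsHomogeneous n :=
  ((hp.C_mul u).add (hq.C_mul v)).add (hr.C_mul w)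

/-- A constant-coefficient combination keeps the degree. -/
private theorem isHomogeneous_comb' {p q r : MvPolynomial (Fin 3) R} {n : ℕ} (hp : p.IsHomogeneous n)
    (hq : q.IsHomogeneous n) (hr : r.IsHomogeneous n) (u v w : R) : (C u * p + C v * q - C w * r).IsHomogeneous n :=
  ((hp.C_mul u).add (hq.C_mul v)).sub (hr.C_mul w)

/-- The rows of `Q²x` are linear forms. [folklore] -/
theorem isHomogeneous_genS0 : (genS0 a b d e f).IsHomogeneous 1 :=
  isHomogeneous_comb (isHomogeneous_genQ0 a b d e f) (isHomogeneous_genQ1 a b d e f) (isHomogeneous_genQ2 a b d e f) a d e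
/-- The rows of `Q²x` are linear forms. [folklore] -/
theorem isHomogeneous_genS1 : (genS1 a b d e f).IsHomogeneous 1 :=
  isHomogeneous_comb (isHomogeneous_genQ0 a b d e f) (isHomogeneous_genQ1 a b d e f) (isHomogeneous_genQ2 a b d e f) d b f
/-- The rows of `Q²x` are linear forms. [folklore] -/
theorem isHomogeneous_genS2 : (genS2 a b d e f).IsHomogeneous 1 :=
  isHomogeneous_comb' (isHomogeneous_genQ0 a b d e f) (isHomogeneous_genQ1 a b d e f) (isHomogeneous_genQ2 a b d e f)
    e f (a + b)

/-- `x₀ p + x₁ q + x₂ r` is homogeneous of degree `n + 1` for `p, q, r` homogeneous of degree `n`. [folklore] -/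
theorem isHomogeneous_X_comb {p q r : MvPolynomial (Fin 3) R} {n : ℕ} (hp : p.IsHomogeneous n)
    (hq : q.IsHomogeneous n) (hr : r.IsHomogeneous n) : (X 0 * p + X 1 * q + X 2 * r).IsHomogeneous (n + 1) := by
  have h := (((isHomogeneous_X R (0 : Fin 3)).mul hp).add ((isHomogeneous_X R (1 : Fin 3)).mul hq)).add
    ((isHomogeneous_X R (2 : Fin 3)).mul hr)
  rwa [add_comm 1 n] at h

/-- `L` is homogeneous of degree two. [folklore] -/
theorem isHomogeneous_genL : (genL a b d e f).IsHomogeneous 2 :=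
  isHomogeneous_X_comb (isHomogeneous_genQ0 a b d e f) (isHomogeneous_genQ1 a b d e f) (isHomogeneous_genQ2 a b d e f)

/-- `M` is homogeneous of degree two. [folklore] -/
theorem isHomogeneous_genM : (genM a b d e f).IsHomogeneous 2 :=
  (((isHomogeneous_genQ0 a b d e f).pow 2).add ((isHomogeneous_genQ1 a b d e f).pow 2)).add
    ((isHomogeneous_genQ2 a b d e f).pow 2)

/-- `W` is homogeneous of degree three. [folklore] -/
theorem isHomogeneous_genW : (genW a b d e f).IsHomogeneous 3 := by
  have hQ0 := isHomogeneous_genQ0 a b d e f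
  have hQ1 := isHomogeneous_genQ1 a b d e f
  have hQ2 := isHomogeneous_genQ2 a b d e f
  have hS0 := isHomogeneous_genS0 a b d e f
  have hS1 := isHomogeneous_genS1 a b d e f
  have hS2 := isHomogeneous_genS2 a b d e f
  have h0 : (genQ1 a b d e f * genS2 a b d e f - genQ2 a b d e f * genS1 a b d e f).IsHomogeneous 2 :=
    (hQ1.mul hS2).sub (hQ2.mul hS1)
  have h1 : (genQ2 a b d e f * genS0 a b d e f - genQ0 a b d e f * genS2 a b d e f).IsHomogeneous 2 :=
    (hQ2.mul hS0).sub (hQ0.mul hS2)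
  have h2 : (genQ0 a b d e f * genS1 a b d e f - genQ1 a b d e f * genS0 a b d e f).IsHomogeneous 2 :=
    (hQ0.mul hS1).sub (hQ1.mul hS0)
  exact isHomogeneous_X_comb h0 h1 h2

/-- `A` is homogeneous of degree four. [folklore] -/
theorem isHomogeneous_genA : (genA a b d e f).IsHomogeneous 4 := by
  have hL := isHomogeneous_genL a b d e f
  have hM := isHomogeneous_genM a b d e f
  have hρ : (normSq : MvPolynomial (Fin 3) R).IsHomogeneous 2 := isHomogeneous_normSq
  have h1 : (C 35 * genL a b d e f ^ 2 : MvPolynomial (Fin 3) R).IsHomogeneous 4 := (hL.pow 2).C_mul _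
  have h2 : (C 20 * normSq * genM a b d e f : MvPolynomial (Fin 3) R).IsHomogeneous 4 := by
    rw [mul_assoc]; exact (hρ.mul hM).C_mul _
  have h3 : (C (2 * genTau a b d e f) * normSq ^ 2 : MvPolynomial (Fin 3) R).IsHomogeneous 4 := (hρ.pow 2).C_mul _
  exact (h1.sub h2).add h3

/-- `B` is homogeneous of degree six. [folklore] -/
theorem isHomogeneous_genB : (genB a b d e f).IsHomogeneous 6 := by
  have hL := isHomogeneous_genL a b d e f
  have hM := isHomogeneous_genM a b d e f
  have hρ : (normSq : MvPolynomial (Fin 3) R).IsHomogeneous 2 := isHomogeneous_normSq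
  have h1 : (C 77 * genL a b d e f ^ 3 : MvPolynomial (Fin 3) R).IsHomogeneous 6 := (hL.pow 3).C_mul _
  have h2 : (C 84 * normSq * genL a b d e f * genM a b d e f : MvPolynomial (Fin 3) R).IsHomogeneous 6 := by
    rw [mul_assoc, mul_assoc]; exact (hρ.mul (hL.mul hM)).C_mul _
  have h3 : (C (14 * genTau a b d e f) * normSq ^ 2 * genL a b d e f : MvPolynomial (Fin 3) R).IsHomogeneous 6 := by
    rw [mul_assoc]; exact ((hρ.pow 2).mul hL).C_mul _
  have h4 : (C (16 * genDelta a b d e f) * normSq ^ 3 : MvPolynomial (Fin 3) R).IsHomogeneous 6 := (hρ.pow 3).C_mul _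
  exact ((h1.sub h2).add h3).add h4

end Generic

end Summit.NavierStokesRegularity.NavierStokesRegularity.Theorems.PoloidalLiouville.HorizonTower.Zonal

end
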